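import Summits.QuantumAdvantage.QuantumAdvantage.Theses.WhiteBoxWalk
import Literature.Computability.Cryptography.Shor

/-!
# Sketch — crux `WbwThesis` (stmt-QuantumAdvantage-2238), crux-ideate round 1, ideator 1

First lemmas of three idea cards, typed over existing declarations:

* §0 clause abstraction: `WbwThesis ↔ ∃ gen ans, gen ∈ FP ∧ PolyLen ∧ ClauseQ ∧ ClauseC` (`Iff.rfl`),
  and the KEYLESS frame `gen = id`: `ClauseQ id ans ↔ ans ∈ FBQP` (`Iff.rfl`), `wbw_of_keyless`.
* §1 card `yao-keyless-factoring`: weak clause (C) (Goldreich-style `1 - 1/q(n)`),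
  the factoring instance `factorAns`, the first lemma `FactoringDirectProduct` and the composition
  `wbw_of_factoringDirectProduct`.
* §2 card `advice-decoding-kummer`: δ-hardness against polynomial advice, the Kummer-trit
  answer function, the first lemma `NonuniformDirectProduct` and `wbw_of_kummer`.
* §3 card `keyless-zeta-long-answer`: planted witnesses give one-way functions (`PlantedGivesOWF` = Disproof §4
  `isOneWay_gen_of_planted`, proved by the disprover), the affine point count of the seed's hyperelliptic curve
  `zetaAns`, and `wbw_of_zeta`.
* Disproof.lean (cdisprove cycle 1) uses the SAME `ClauseQ`/`ClauseC` abstraction (`wbwThesis_iff` by `Iff.rfl` in both).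

Nothing here is a proof of the crux; the `_of_` theorems are the (trivial) compositions showing each
line concludes `WbwThesis` BY NAME. Stated first lemmas are `def … : Prop`.
-/

noncomputable section

set_option linter.dupNamespace false

namespace Summit.QuantumAdvantage.QuantumAdvantage.Cruxes.WbwThesis.Ideator1

open Summit.QuantumAdvantage.QuantumAdvantage.Theses.WhiteBoxWalk
open Literature.Computability.Complexity Literature.Computability.Cryptography
open Filter Asymptotics Computability

/-! ### §0  Clauses and the keyless frame -/

/-- Clause (Q) of `WbwThesis` for a pair `(gen, ans)`. -/
def ClauseQ (gen ans : List Bool → List Bool) : Prop :=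
  ∃ F : QCircuitFamily cliffordT, F.IsOracleFree ∧ F.IsUniform ∧
    ∀ s, 2 / 3 ≤ F.kernelProb 0 (gen s) {y | ans s <+: y}

/-- Success probability of `A` at security parameter `n`: outputs (a string with prefix) `ans s`
on input `(1ⁿ, gen s)`, averaged over `s ← U_n`. -/
def succAvg (gen ans : List Bool → List Bool) (A : RandAlg (List Bool) (List Bool)) (n : ℕ) : ℝ :=
  uniformAvg n fun s => A.pr id (boolPair (unaryEncodeNat n) (gen s)) {y | ans s <+: y}

/-- Clause (C) of `WbwThesis`: negligible success for every PPT. -/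
def ClauseC (gen ans : List Bool → List Bool) : Prop :=
  ∀ A : RandAlg (List Bool) (List Bool), IsPPT A id →
    SuperpolynomialDecay atTop (fun n : ℕ => (n : ℝ)) (succAvg gen ans A)

/-- Exact polynomial answer length. -/
def PolyLen (gen ans : List Bool → List Bool) : Prop :=
  ∃ p : Polynomial ℕ, ∀ s, (ans s).length = p.eval (gen s).length

/-- The crux, clause by clause (definitional). -/
theorem wbwThesis_iff :
    WbwThesis ↔ ∃ gen ans : List Bool → List Bool,
      PolyTimeComputable id id gen ∧ PolyLen gen ans ∧ ClauseQ gen ans ∧ ClauseC gen ans :=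
  Iff.rfl

/-- KEYLESS FRAME: with `gen = id`, clause (Q) is literally membership of `ans` in the tree's `FBQP`. -/
theorem clauseQ_id_iff (ans : List Bool → List Bool) : ClauseQ id ans ↔ ans ∈ FBQP :=
  Iff.rfl

/-- Keyless witnesses close the crux: `ans ∈ FBQP`, exact polynomial length, clause (C) on UNIFORM seeds. -/
theorem wbw_of_keyless (ans : List Bool → List Bool) (hQ : ans ∈ FBQP)
    (hlen : ∃ p : Polynomial ℕ, ∀ s, (ans s).length = p.eval s.length) (hC : ClauseC id ans) :
    WbwThesis :=
  ⟨id, ans, PolyTimeComputable.id _, hlen, (clauseQ_id_iff ans).2 hQ, hC⟩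

/-! ### Shared plumbing: raw binary value, chunks, fixed-width encodings -/

/-- Plain LSB-first binary value of a bit string (every `n`-bit string ↦ a number in `[0, 2ⁿ)`, bijectively). -/
def binVal : List Bool → ℕ
  | [] => 0
  | b :: l => (if b then 1 else 0) + 2 * binVal l

/-- Fixed-width LSB-first binary encoding of `v` on `w` bits (value taken mod `2^w`). -/
def toBitsW (w v : ℕ) : List Bool :=
  (List.range w).map fun i => v.testBit i

/-- The `i`-th chunk of length `m` of a bit string. -/
def chunkAt (m i : ℕ) (s : List Bool) : List Bool :=
  (s.drop (i * m)).take m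

/-! ### §1  Card `yao-keyless-factoring` -/

/-- WEAK clause (C) (Goldreich 2001 Def. 2.2.2 style): one polynomial `q` such that every PPT
fails with probability at least `1/q(n)` for all large `n`. -/
def WeakClauseC (gen ans : List Bool → List Bool) : Prop :=
  ∃ q : Polynomial ℕ, (∀ n, 0 < q.eval n) ∧
    ∀ A : RandAlg (List Bool) (List Bool), IsPPT A id →
      ∀ᶠ n in atTop, succAvg gen ans A n ≤ 1 - 1 / ((q.eval n : ℕ) : ℝ)

/-- The keyless factoring answer: the prime factorisation (with multiplicity, nondecreasing) of the
binary value of the seed, in the tree's list-of-naturals encoding (variable length; padded later). -/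
def factorAns (s : List Bool) : List Bool :=
  encodingListNatBool.encode (binVal s).primeFactorsList

/-- HYPOTHESIS of card 1 (conjecture-grade, Shor-tier): completely factoring a UNIFORM `n`-bit integer is
weakly hard — some polynomial `q` such that every PPT outputs `primeFactorsList` with probability
`≤ 1 - 1/q(n)` for all large `n`. (Expected truth: even a constant gap, by the positive density of
integers with two prime factors `> 2^{n/4}`.) -/
def WeakUniformFactoring : Prop :=
  WeakClauseC id factorAns

/-- FIRST LEMMA of card 1 (Yao's direct product, keyless & verifiable; Goldreich Thm 2.3.2 template =
tree `YaoAmplification.lean`, with "first verified preimage" replaced by "accepted candidate with the most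
parts", so that NO primality test is needed): from `WeakUniformFactoring`, the `t(n)`-fold padded
concatenation `ans⁽ᵗ⁾` is in `FBQP` (from `factoring_mem_FBQP_holds` + `FP^{FBQP} ⊆ FBQP` plumbing), has
exact polynomial length, and satisfies the NEGLIGIBLE clause (C) on uniform seeds. -/
def FactoringDirectProduct : Prop :=
  WeakUniformFactoring →
    ∃ ans : List Bool → List Bool, ans ∈ FBQP ∧
      (∃ p : Polynomial ℕ, ∀ s, (ans s).length = p.eval s.length) ∧ ClauseC id ans

/-- Composition: the line concludes the crux by name. -/
theorem wbw_of_factoringDirectProduct (h : FactoringDirectProduct) (hw : WeakUniformFactoring) :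
    WbwThesis := by
  obtain ⟨ans, hQ, hlen, hC⟩ := h hw
  exact wbw_of_keyless ans hQ hlen hC

/-- The abstract form of the lever (regime "uniform + public verification"): for ANY pair with a
poly-time verifier of answers, weak (C) upgrades to negligible (C) for a product pair, (Q) being preserved. -/
def VerifiableDirectProduct : Prop :=
  ∀ gen ans : List Bool → List Bool,
    PolyTimeComputable id id gen →
    (∃ p : Polynomial ℕ, ∀ s, (ans s).length ≤ p.eval (gen s).length) →
    (∃ V : List Bool → List Bool, PolyTimeComputable id id V ∧
        ∀ s a, V (boolPair (gen s) a) = [true] ↔ a = ans s) →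
    ClauseQ gen ans → WeakClauseC gen ans →
      ∃ gen' ans' : List Bool → List Bool,
        PolyTimeComputable id id gen' ∧ PolyLen gen' ans' ∧ ClauseQ gen' ans' ∧ ClauseC gen' ans'

theorem wbw_of_verifiableDirectProduct (h : VerifiableDirectProduct) {gen ans : List Bool → List Bool}
    (hg : PolyTimeComputable id id gen) (hl : ∃ p : Polynomial ℕ, ∀ s, (ans s).length ≤ p.eval (gen s).length)
    (hV : ∃ V : List Bool → List Bool, PolyTimeComputable id id V ∧ ∀ s a, V (boolPair (gen s) a) = [true] ↔ a = ans s)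
    (hQ : ClauseQ gen ans) (hW : WeakClauseC gen ans) : WbwThesis := by
  obtain ⟨gen', ans', h1, h2, h3, h4⟩ := h gen ans hg hl hV hQ hW
  exact ⟨gen', ans', h1, h2, h3, h4⟩

/-! ### §2  Card `advice-decoding-kummer` -/

/-- Success with polynomial advice `a n` (tree convention for non-uniformity, as in `IsOneWayNonuniform`). -/
def succAvgAdv (gen ans : List Bool → List Bool) (A : RandAlg (List Bool) (List Bool))
    (a : ℕ → List Bool) (n : ℕ) : ℝ :=
  uniformAvg n fun s => A.pr id (boolPair (a n) (boolPair (unaryEncodeNat n) (gen s))) {y | ans s <+: y}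

/-- MILD NON-UNIFORM average-case hardness: every PPT with polynomial advice errs with probability
`≥ δ n` for all large `n`. -/
def AdvHard (δ : ℕ → ℝ) (gen ans : List Bool → List Bool) : Prop :=
  ∀ A : RandAlg (List Bool) (List Bool), IsPPT A id → ∀ a : ℕ → List Bool, IsPolyLength a →
    ∀ᶠ n in atTop, succAvgAdv gen ans A a n ≤ 1 - δ n

/-- FIRST LEMMA of card 2 (Impagliazzo 1995 / Goldreich–Nisan–Wigderson direct product, NON-uniform,
no verifier, no planter; engine = tree `HardCoreLemma.lean`): δ-hardness against polynomial advice with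
`δ ≥ 1/q` upgrades, for the `t = n·q(n)`-fold padded product, to negligible success against polynomial
advice — hence against uniform PPT, i.e. clause (C) — while (Q) is preserved. -/
def NonuniformDirectProduct : Prop :=
  ∀ (gen ans : List Bool → List Bool) (q : Polynomial ℕ), (∀ n, 0 < q.eval n) →
    PolyTimeComputable id id gen →
    (∃ p : Polynomial ℕ, ∀ s, (ans s).length ≤ p.eval (gen s).length) →
    ClauseQ gen ans → AdvHard (fun n => 1 / ((q.eval n : ℕ) : ℝ)) gen ans →
      ∃ gen' ans' : List Bool → List Bool,
        PolyTimeComputable id id gen' ∧ PolyLen gen' ans' ∧ ClauseQ gen' ans' ∧ ClauseC gen' ans'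

/-- Kummer's real cubic sum `G_p = Σ_{x<p} cos(2π x³/p)` (verbatim the quantity of route KummerSector). -/
def kummerG (p : ℕ) : ℝ :=
  ∑ x ∈ Finset.range p, Real.cos (2 * Real.pi * (x : ℝ) ^ 3 / (p : ℝ))

/-- Kummer's trit of `p` on two bits: class I `[true,true]`, II `[true,false]`, III `[false,true]`;
`[false,false]` on non-instances (p not a prime ≡ 1 mod 3). -/
def kummerAns (s : List Bool) : List Bool :=
  let p := binVal s
  if p.Prime ∧ p % 3 = 1 then
    (if Real.sqrt p < kummerG p then [true, true]
     else if -Real.sqrt p < kummerG p then [true, false] else [false, true])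
  else [false, false]

/-- (Q)-side support of card 2: the trit FUNCTION is in FBQP — follows from KummerSector's cruxes
`KsMemBQP ∧ KsLowerClassesMemBQP` (three BQP languages) plus primality inside BQP
(`factoring_mem_FBQP_holds`) and classical-wrap plumbing. Theorem in print (vanDamSeroussi2002 Thm 1). -/
def KummerTritFBQP : Prop :=
  kummerAns ∈ FBQP

/-- HYPOTHESIS of card 2 (conjecture-grade, NEW, Shor-free): Kummer's trit of a uniform `n`-bit
number (trivial off the primes ≡ 1 mod 3, which have density ≍ 1/n) is `1/q(n)`-hard for PPT with
polynomial advice, for some polynomial `q`. -/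
def KummerTritAdvHard : Prop :=
  ∃ q : Polynomial ℕ, (∀ n, 0 < q.eval n) ∧ AdvHard (fun n => 1 / ((q.eval n : ℕ) : ℝ)) id kummerAns

/-- Composition: the line concludes the crux by name. -/
theorem wbw_of_kummer (h : NonuniformDirectProduct) (hQ : KummerTritFBQP) (hH : KummerTritAdvHard) :
    WbwThesis := by
  obtain ⟨q, hq, hA⟩ := hH
  have hlen : ∃ p : Polynomial ℕ, ∀ s, (kummerAns s).length ≤ p.eval (id s).length := by
    refine ⟨Polynomial.C 2, fun s => ?_⟩
    simp only [kummerAns, Polynomial.eval_C]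
    split_ifs <;> simp
  obtain ⟨gen', ans', h1, h2, h3, h4⟩ :=
    h id kummerAns q hq (PolyTimeComputable.id _) hlen ((clauseQ_id_iff _).2 hQ) hA
  exact ⟨gen', ans', h1, h2, h3, h4⟩

/-! ### §3  Card `keyless-zeta-long-answer` -/

/-- STRUCTURE LEMMA = the standing disprover's `Disproof.isOneWay_gen_of_planted` (Cruxes/WbwThesis/Disproof.lean
§4, cycle 1, PROVED sorry-free; typed here independently as the interface card 3 reads thesis-side): a PLANTED
witness — one whose answer is poly-time computable FROM THE SEED — makes its generator a (strong) one-way function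
in the tree's sense `IsOneWay`. (Inverter ↦ answerer: a preimage `s'` of `gen s` has `ans s' = ans s` by (Q).) -/
def PlantedGivesOWF : Prop :=
  ∀ gen ans : List Bool → List Bool,
    PolyTimeComputable id id gen → PolyLen gen ans → ClauseQ gen ans → ClauseC gen ans →
    PolyTimeComputable id id ans → IsOneWay gen

/-- (Q)-consistency, the one fact about (Q) the structure lemma uses: equal instances have equal
answers (two distinct equal-length prefixes cannot both have probability ≥ 2/3). Provable now. -/
def AnsRespectsGen : Prop :=
  ∀ gen ans : List Bool → List Bool, PolyLen gen ans → ClauseQ gen ans →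
    ∀ s s', gen s = gen s' → ans s = ans s'

/-- Affine point count `N₁ = #{(x,y) ∈ 𝔽_p² : y² = f(x)}` of the curve cut out by a coefficient list
(monic `f` of degree `cs.length`, coefficients read mod `p`). -/
def affineCount (p : ℕ) (cs : List ℕ) : ℕ :=
  if hp : p.Prime then
    haveI := Fact.mk hp
    Fintype.card {xy : ZMod p × ZMod p //
      xy.2 ^ 2 = xy.1 ^ cs.length + ∑ i : Fin cs.length, ((cs.get i : ℕ) : ZMod p) * xy.1 ^ (i : ℕ)}
  else 0

/-- The KEYLESS ZETA ANSWER of a seed `s` of length `N`: with `m = ⌊N^{1/4}⌋`, the first `m²` chunks of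
length `m` are prime candidates (`p` = the first prime among their binary values, `0` if none — an event
of probability `≈ (1 - 1.44/m)^{m²} = e^{-Ω(m)}`, negligible), the next `2m+1` chunks are the coefficients
of a monic `f` of degree `2m+1` over `𝔽_p` (a genus-`m` hyperelliptic model when squarefree), and the
answer is the affine count `N₁` written on `N+3` bits (fixed polynomial width; `N₁ ≤ p² < 2^{2m}`).
Bits used: `m³ + (2m+1)m ≤ m⁴ ≤ N` for `m ≥ 3`. Genus ≍ log p: the joint regime where Schoof–Pila
(exponential in g) and p-adic methods (exponential in log p) both fail classically, and Kedlaya 2006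
Thm 1 is polynomial quantumly. -/
def zetaAns (s : List Bool) : List Bool :=
  let m := Nat.sqrt (Nat.sqrt s.length)
  let cands := (List.range (m * m)).map fun i => binVal (chunkAt m i s)
  let p := (cands.find? fun c => decide c.Prime).getD 0
  let coeffs := (List.range (2 * m + 1)).map fun j => binVal (chunkAt m (m * m + j) s)
  toBitsW (s.length + 3) (affineCount p coeffs)

/-- (Q)-side support of card 3 — KEDLAYA'S THEOREM in the tree's model (cite-fact, arXiv:math/0411623
Thm 1 + Lemma 10, unconditional; plus first-prime selection by `factoring_mem_FBQP_holds`). -/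
def ZetaCountFBQP : Prop :=
  zetaAns ∈ FBQP

/-- HYPOTHESIS of card 3 (conjecture-grade, keyless, factoring/DLOG/iO-independent): no PPT outputs the
affine point count of the seed's random genus-`m` curve over the seed's random `m`-bit prime field with
non-negligible probability over uniform seeds. -/
def ZetaCountHard : Prop :=
  ClauseC id zetaAns

theorem length_zetaAns (s : List Bool) : (zetaAns s).length = s.length + 3 := by
  simp [zetaAns, toBitsW]

/-- Composition: the line concludes the crux by name (no amplification: one long exact answer). -/
theorem wbw_of_zeta (hQ : ZetaCountFBQP) (hC : ZetaCountHard) : WbwThesis :=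
  wbw_of_keyless zetaAns hQ ⟨Polynomial.X + Polynomial.C 3, fun s => by simp [length_zetaAns]⟩ hC

/-! ### Sanity -/

example : binVal [true, false, true] = 5 := by simp [binVal]
example : (toBitsW 4 5) = [true, false, true, false] := by decide
example : kummerAns [] = [false, false] := by simp [kummerAns, binVal]
example (s : List Bool) : (zetaAns s).length = s.length + 3 := length_zetaAns s

end Summit.QuantumAdvantage.QuantumAdvantage.Cruxes.WbwThesis.Ideator1
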